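import Mathlib

/-!
# Stub `stub_integralModels` — integral short-Weierstrass models of the two elliptic quotients
(crux `BiellipticRealPeriodCell`, stmt-KontsevichZagierPeriods-18685, line `Sketch`)

For a cubic `G = g₃X³ + g₂X² + g₁X + g₀ ∈ ℚ[X]` with `G(X²)` squarefree, the two elliptic
quotients of the bielliptic curve `y² = G(x²)` are `E₁ : y² = G(u)` (`u = x²`) and
`E₂ : w² = G*(v)`, `G*(v) = v³G(1/v) = g₀v³ + g₁v² + g₂v + g₃` (`v = x⁻²`). A rational affine
substitution `u = m t + s` (resp. `v = m t + s`) followed by clearing denominators moves each onto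
an INTEGRAL short Weierstrass model: `H(m t + s) = k²(t³ + A t + B)`, `A, B ∈ ℤ`,
`4A³ + 27B² ≠ 0`. We prove this for a general rational cubic `H = h₃X³ + h₂X² + h₁X + h₀`
(`h₃ ≠ 0`) as four coefficient identities (`exists_model`: depress with `s = -h₂/(3h₃)`, scale by
`λ = 1/N` with `N` the product of the two denominators), show that a singular model
(`4A³ + 27B² = 0`, i.e. `t³ + At + B = (t - t₀)²(t + 2t₀)` with `t₀ ∈ ℚ`) forces the complete
rational factorisation `m³H = k²(X - r)²(X - r')` (`factor_of_disc_eq_zero`), and pull the square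
factor back to a non-unit square factor of `G(X²)` — contradicting squarefreeness. The two models
(`H = G` and `H = G*`) are finally evaluated at `u = y²`, `v = y⁻²` (denominators cleared, so the
second identity is polynomial in `y` and holds at `y = 0` too), giving exactly the two real
identities consumed by the moves of the line. Mathlib only; no definitions are introduced.
-/

noncomputable section

open Polynomial Set

namespace Summit.KontsevichZagierPeriods.IsogenyCertificates.BiellipticRealPeriodCellStubs.IntegralModels

/-- A depressed cubic `t³ + At + B` with `4A³ + 27B² = 0` has the shape `A = -3t₀²`, `B = 2t₀³`
for a rational `t₀` (so that `t³ + At + B = (t - t₀)²(t + 2t₀)`). [folklore] -/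
theorem exists_doubleRoot_of_disc_eq_zero {A B : ℚ} (h : 4 * A ^ 3 + 27 * B ^ 2 = 0) :
    ∃ t₀ : ℚ, A = -3 * t₀ ^ 2 ∧ B = 2 * t₀ ^ 3 := by
  by_cases hA : A = 0
  · subst hA
    have hB2 : B ^ 2 = 0 := by linarith
    have hB : B = 0 := pow_eq_zero_iff (two_ne_zero) |>.mp hB2
    exact ⟨0, by simp, by simp [hB]⟩
  · have hB : B ≠ 0 := by
      rintro rfl
      apply hA
      have hA3 : A ^ 3 = 0 := by linarith
      exact pow_eq_zero_iff (by norm_num) |>.mp hA3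
    refine ⟨-3 * B / (2 * A), ?_, ?_⟩
    · field_simp
      linear_combination h
    · field_simp
      linear_combination h

/-- Clearing denominators: two rationals become integers after scaling by `N⁴`, resp. `N⁶`, for a
suitable positive natural number `N` (the product of their denominators). -/
theorem exists_integral_scaling (r₁ r₂ : ℚ) :
    ∃ (N : ℕ) (A B : ℤ), 0 < N ∧ (A : ℚ) = r₁ * (N : ℚ) ^ 4 ∧ (B : ℚ) = r₂ * (N : ℚ) ^ 6 := by
  have h1 : (r₁.num : ℚ) = r₁ * r₁.den := (Rat.mul_den_eq_num r₁).symm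
  have h2 : (r₂.num : ℚ) = r₂ * r₂.den := (Rat.mul_den_eq_num r₂).symm
  refine ⟨r₁.den * r₂.den, r₁.num * r₂.den * ((r₁.den : ℤ) * r₂.den) ^ 3,
    r₂.num * r₁.den * ((r₁.den : ℤ) * r₂.den) ^ 5, Nat.mul_pos r₁.den_pos r₂.den_pos, ?_, ?_⟩
  · push_cast
    rw [h1]
    ring
  · push_cast
    rw [h2]
    ring

/-- **Integral short-Weierstrass model of a rational cubic.** For `H = h₃X³ + h₂X² + h₁X + h₀`
with `h₃ ≠ 0` there are `m, k ∈ ℚˣ`, `s ∈ ℚ`, `A, B ∈ ℤ` with `H(m t + s) = k²(t³ + At + B)`,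
stated as the four coefficient identities of `m³·H(X) = k²((X - s)³ + A m²(X - s) + B m³)`.
[folklore] -/
theorem exists_model (h₃ h₂ h₁ h₀ : ℚ) (h3 : h₃ ≠ 0) :
    ∃ (m s k : ℚ) (A B : ℤ), m ≠ 0 ∧ k ≠ 0 ∧ k ^ 2 = m ^ 3 * h₃ ∧
      m ^ 3 * h₂ = -3 * s * k ^ 2 ∧ m ^ 3 * h₁ = k ^ 2 * (3 * s ^ 2 + A * m ^ 2) ∧
      m ^ 3 * h₀ = k ^ 2 * (B * m ^ 3 - s ^ 3 - A * m ^ 2 * s) := by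
  obtain ⟨s, hs⟩ : ∃ s : ℚ, h₂ = -3 * h₃ * s := ⟨-h₂ / (3 * h₃), by field_simp⟩
  obtain ⟨N, A, B, hN, hA, hB⟩ := exists_integral_scaling ((h₁ - 3 * h₃ * s ^ 2) / h₃ ^ 3)
    ((h₀ + h₁ * s - 2 * h₃ * s ^ 3) / h₃ ^ 4)
  have hN0 : (N : ℚ) ≠ 0 := by exact_mod_cast hN.ne'
  refine ⟨h₃ / N ^ 2, s, h₃ ^ 2 / N ^ 3, A, B, div_ne_zero h3 (pow_ne_zero _ hN0),
    div_ne_zero (pow_ne_zero _ h3) (pow_ne_zero _ hN0), ?_, ?_, ?_, ?_⟩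
  · field_simp
  · rw [hs]
    field_simp
  · rw [hA]
    field_simp
    ring
  · rw [hA, hB]
    field_simp
    ring

/-- A singular model forces a complete rational factorisation: if the four model identities hold
and `4A³ + 27B² = 0` then `m³·H(X) = k²(X - r)²(X - r')` coefficientwise, for some `r, r' ∈ ℚ`.
[folklore] -/
theorem factor_of_disc_eq_zero {h₂ h₁ h₀ m s k : ℚ} {A B : ℤ}
    (e₂ : m ^ 3 * h₂ = -3 * s * k ^ 2) (e₁ : m ^ 3 * h₁ = k ^ 2 * (3 * s ^ 2 + A * m ^ 2))
    (e₀ : m ^ 3 * h₀ = k ^ 2 * (B * m ^ 3 - s ^ 3 - A * m ^ 2 * s))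
    (hdisc : 4 * A ^ 3 + 27 * B ^ 2 = 0) :
    ∃ r r' : ℚ, m ^ 3 * h₂ = -(k ^ 2 * (2 * r + r')) ∧
      m ^ 3 * h₁ = k ^ 2 * (r ^ 2 + 2 * r * r') ∧ m ^ 3 * h₀ = -(k ^ 2 * (r ^ 2 * r')) := by
  obtain ⟨t₀, hA, hB⟩ :=
    exists_doubleRoot_of_disc_eq_zero (A := (A : ℚ)) (B := (B : ℚ)) (by exact_mod_cast hdisc)
  refine ⟨s + m * t₀, s - 2 * m * t₀, ?_, ?_, ?_⟩
  · linear_combination e₂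
  · linear_combination e₁ + k ^ 2 * m ^ 2 * hA
  · linear_combination e₀ + k ^ 2 * m ^ 3 * hB - k ^ 2 * m ^ 2 * s * hA

/-- The four model identities read over `ℝ`, homogenised: for all real `u, w`,
`m³(h₃u³ + h₂u²w + h₁uw² + h₀w³) = k²((u - sw)³ + A m² w²(u - sw) + B m³ w³)`
(`w = 1`: the model of `H` at `u`; `u = 1`: the model of the reversed cubic at `w`). -/
theorem model_eval {h₃ h₂ h₁ h₀ m s k : ℚ} {A B : ℤ} (e₃ : k ^ 2 = m ^ 3 * h₃)
    (e₂ : m ^ 3 * h₂ = -3 * s * k ^ 2) (e₁ : m ^ 3 * h₁ = k ^ 2 * (3 * s ^ 2 + A * m ^ 2))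
    (e₀ : m ^ 3 * h₀ = k ^ 2 * (B * m ^ 3 - s ^ 3 - A * m ^ 2 * s)) (u w : ℝ) :
    (m : ℝ) ^ 3 * (h₃ * u ^ 3 + h₂ * u ^ 2 * w + h₁ * u * w ^ 2 + h₀ * w ^ 3) =
      (k : ℝ) ^ 2 * ((u - s * w) ^ 3 + A * m ^ 2 * w ^ 2 * (u - s * w) + B * m ^ 3 * w ^ 3) := by
  have e₃' : (k : ℝ) ^ 2 = (m : ℝ) ^ 3 * (h₃ : ℝ) := by exact_mod_cast e₃
  have e₂' : (m : ℝ) ^ 3 * (h₂ : ℝ) = -3 * (s : ℝ) * (k : ℝ) ^ 2 := by exact_mod_cast e₂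
  have e₁' : (m : ℝ) ^ 3 * (h₁ : ℝ) = (k : ℝ) ^ 2 * (3 * (s : ℝ) ^ 2 + (A : ℝ) * (m : ℝ) ^ 2) := by
    exact_mod_cast e₁
  have e₀' : (m : ℝ) ^ 3 * (h₀ : ℝ) =
      (k : ℝ) ^ 2 * ((B : ℝ) * (m : ℝ) ^ 3 - (s : ℝ) ^ 3 - (A : ℝ) * (m : ℝ) ^ 2 * (s : ℝ)) := by
    exact_mod_cast e₀
  linear_combination (-u ^ 3) * e₃' + u ^ 2 * w * e₂' + u * w ^ 2 * e₁' + w ^ 3 * e₀'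

/-- **C — integral short-Weierstrass models of the two elliptic quotients.** For `G` cubic with
`G(X²)` squarefree there are rational affine substitutions `u = m₁t + s₁`, `v = m₂t + s₂` and
`k₁, k₂ ∈ ℚˣ`, `(Aᵢ, Bᵢ) ∈ ℤ²` nonsingular, with `G(m₁t + s₁) = k₁²(t³ + A₁t + B₁)` and
`G*(m₂t + s₂) = k₂²(t³ + A₂t + B₂)` (`G*(v) = v³G(1/v)`), stated as the two real identities in
`y` (`u = y²`, `v = y⁻²`, denominators cleared) that the moves consume. -/
theorem stub_integralModels : ∀ (G : ℚ[X]), G.natDegree = 3 → Squarefree (G.comp (X ^ 2)) →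
    (∃ (m s k : ℚ) (A B : ℤ), m ≠ 0 ∧ k ≠ 0 ∧ 4 * A ^ 3 + 27 * B ^ 2 ≠ 0 ∧
      ∀ y : ℝ, (m : ℝ) ^ 3 * aeval y (G.comp (X ^ 2)) =
        (k : ℝ) ^ 2 * ((y ^ 2 - s) ^ 3 + (A : ℝ) * m ^ 2 * (y ^ 2 - s) + (B : ℝ) * m ^ 3)) ∧
    (∃ (m s k : ℚ) (A B : ℤ), m ≠ 0 ∧ k ≠ 0 ∧ 4 * A ^ 3 + 27 * B ^ 2 ≠ 0 ∧
      ∀ y : ℝ, (m : ℝ) ^ 3 * aeval y (G.comp (X ^ 2)) =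
        (k : ℝ) ^ 2 * ((1 - s * y ^ 2) ^ 3 + (A : ℝ) * m ^ 2 * y ^ 4 * (1 - s * y ^ 2) +
          (B : ℝ) * m ^ 3 * y ^ 6)) := by
  intro G hdeg hsq
  -- the four coefficients and the explicit shape of `G(X²)`
  have hG : G = C (G.coeff 0) + C (G.coeff 1) * X + C (G.coeff 2) * X ^ 2 +
      C (G.coeff 3) * X ^ 3 := by
    have h := G.as_sum_range_C_mul_X_pow' (n := 4) (by omega)
    simpa [Finset.sum_range_succ] using h
  set g₀ : ℚ := G.coeff 0 with hg₀
  set g₁ : ℚ := G.coeff 1 with hg₁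
  set g₂ : ℚ := G.coeff 2 with hg₂
  set g₃ : ℚ := G.coeff 3 with hg₃
  have hF : G.comp (X ^ 2) = C g₀ + C g₁ * X ^ 2 + C g₂ * X ^ 4 + C g₃ * X ^ 6 := by
    conv_lhs => rw [hG]
    simp only [add_comp, mul_comp, C_comp, X_comp, pow_comp]
    ring
  have hev : ∀ y : ℝ, aeval y (G.comp (X ^ 2)) =
      (g₀ : ℝ) + (g₁ : ℝ) * y ^ 2 + (g₂ : ℝ) * y ^ 4 + (g₃ : ℝ) * y ^ 6 := by
    intro y
    rw [hF]
    simp only [map_add, map_mul, map_pow, aeval_C, aeval_X, eq_ratCast]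
  have hG0 : G ≠ 0 := by
    rintro rfl
    simp at hdeg
  have h3 : g₃ ≠ 0 := by
    rw [hg₃, ← hdeg, coeff_natDegree]
    exact leadingCoeff_ne_zero.mpr hG0
  -- a non-unit square factor of `G(X²)` is absurd
  have key : ∀ (c : ℚ) (D E : ℚ[X]), c ≠ 0 → C c * G.comp (X ^ 2) = D ^ 2 * E →
      D.natDegree ≠ 0 → False := by
    intro c D E hc hfac hD
    have hdvd : D * D ∣ G.comp (X ^ 2) := by
      refine ⟨C c⁻¹ * E, ?_⟩
      calc G.comp (X ^ 2) = C c⁻¹ * (C c * G.comp (X ^ 2)) := by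
            rw [← mul_assoc, ← C_mul, inv_mul_cancel₀ hc, C_1, one_mul]
        _ = D * D * (C c⁻¹ * E) := by rw [hfac]; ring
    exact hD (natDegree_eq_zero_of_isUnit (hsq D hdvd))
  have h0 : g₀ ≠ 0 := by
    intro h0
    refine key 1 X (C g₁ + C g₂ * X ^ 2 + C g₃ * X ^ 4) one_ne_zero ?_ (by simp)
    rw [hF, h0, C_0, C_1]
    ring
  refine ⟨?_, ?_⟩
  · -- the model of `G` itself, read at `u = y²`
    obtain ⟨m, s, k, A, B, hm, hk, e₃, e₂, e₁, e₀⟩ := exists_model g₃ g₂ g₁ g₀ h3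
    refine ⟨m, s, k, A, B, hm, hk, ?_, ?_⟩
    · intro hdisc
      obtain ⟨r, r', f₂, f₁, f₀⟩ := factor_of_disc_eq_zero e₂ e₁ e₀ hdisc
      refine key (m ^ 3) (X ^ 2 - C r) (C (k ^ 2) * (X ^ 2 - C r')) (pow_ne_zero _ hm) ?_ ?_
      · rw [hF]
        refine Polynomial.funext fun x => ?_
        simp only [eval_add, eval_sub, eval_mul, eval_pow, eval_C, eval_X]
        linear_combination (-x ^ 6) * e₃ + x ^ 4 * f₂ + x ^ 2 * f₁ + f₀
      · rw [natDegree_X_pow_sub_C]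
        exact two_ne_zero
    · intro y
      rw [hev y]
      linear_combination model_eval e₃ e₂ e₁ e₀ (y ^ 2) 1
  · -- the model of `G*(v) = g₀v³ + g₁v² + g₂v + g₃`, read at `v = y⁻²` and multiplied by `y⁶`
    obtain ⟨m, s, k, A, B, hm, hk, e₃, e₂, e₁, e₀⟩ := exists_model g₀ g₁ g₂ g₃ h0
    refine ⟨m, s, k, A, B, hm, hk, ?_, ?_⟩
    · intro hdisc
      obtain ⟨r, r', f₂, f₁, f₀⟩ := factor_of_disc_eq_zero e₂ e₁ e₀ hdisc
      by_cases hr : r = 0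
      · apply h3
        have : m ^ 3 * g₃ = 0 := by rw [f₀, hr]; ring
        exact (mul_eq_zero.mp this).resolve_left (pow_ne_zero _ hm)
      refine key (m ^ 3) (C r * X ^ 2 - C 1) (C (k ^ 2) * (C 1 - C r' * X ^ 2))
        (pow_ne_zero _ hm) ?_ ?_
      · rw [hF]
        refine Polynomial.funext fun x => ?_
        simp only [eval_add, eval_sub, eval_mul, eval_pow, eval_C, eval_X]
        linear_combination (-1 : ℚ) * e₃ + x ^ 2 * f₂ + x ^ 4 * f₁ + x ^ 6 * f₀
      · rw [natDegree_sub_C, natDegree_C_mul_X_pow 2 r hr]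
        exact two_ne_zero
    · intro y
      rw [hev y]
      linear_combination model_eval e₃ e₂ e₁ e₀ 1 (y ^ 2)

end Summit.KontsevichZagierPeriods.IsogenyCertificates.BiellipticRealPeriodCellStubs.IntegralModels
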